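import Mathlib.Tactic.Linarith
import Mathlib.Tactic.Ring
import Mathlib.Tactic.NormNum
import HarnessLib

/-!
# The (0,1) cell of the ι-window, EXISTENCE side, XI: the Kummer weld at the node parameter —
# arithmetic skeleton of `H2-EXISTENCE-SIDE-11.md`

Family `hodge`, b2b cell `hweil`, `Summits/HodgeConjecture/HodgeConjecture/Theorems` (helper of item stmt-HodgeConjecture-2524, the
Weil-sixfold rung the H2 test serves). Companion to `WeilTypeLadderH2W2CornerEight/Nine/Ten.lean` ([VIII], [IX], [X]) with the SAME dictionary:
`X = J(C)`, `C` general of genus `4` on the quadric `Q` (rulings `g`, `h`), `ι = −1`, `Θ = W₃ − κ` with nodes `±n`, `D_n = Θ_n ∪ Θ_{−n} ∈ |2Θ|`,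
`S_n = C − C` with vertex `0`, the saturated `j = 2` corner sheaves `F̂_{z₁}` (pinching curve `Z₁ = z₁ − C`), the rank-2 bundle `𝓥₁ = (F̂ ⊗ 𝒪_{Z₁})/tors`
of degree `8` ([VIII] 9.4: an extension of `B` (degree `6`) by `A(−2P)` (degree `2`)), its saturated sub-line-bundles `K` of degree `k` with vertex gluing
`δ ∈ {0,2}` and junk length `ℓ₀ = δ + 2k − 6` ([X] A.7), the candidates `F_K = ker(F̂_{z₁} ↠ 𝓥₁/K ⊕ ι^*(𝓥₁/K))`, in particular [X] B's family
`F^{R0}_{z₁}` (`K = K₀ = A(−2P)`). NEW objects of the report: the constant planes `Π′ = cone(ℓ′)` (`ℓ′` the `g`-line through `z₁`) and `Π″ = cone(ℓ^h_{z₁})`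
in `T_0J = k⁴`; the pencil `{K_v}_{[v] ∈ ℓ′}`; the `σ`-family of degree-2 subbundles and the `V₊`-partner `K_{σ₊}` of `K₀`; the RIGID TWO-SIDED KUMMER MOVE
`β` (`Θ_n`-side data translated by `+εβ`, `Θ_{−n}`-side by `−εβ`); the 15 ι-invariant motions of `D_n` in `|2Θ|`. Report
`run/shared/lean/b2b/hodge-weil/b2b-hweil-pv3-g18/H2-EXISTENCE-SIDE-11.md`, CLAIM TABLE v52 (LADDER C330) row pv3-g18; faithful machine model
`run/shared/lean/b2b/hodge-weil/code/pv3-g18/`. Def-free, fully proved ELEMENTARY statements (integer bookkeeping); the sheaf / module theory and the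
machine computations are in the docstrings and the report. HONEST FRAMING: census / structure results about one cell of the ladder's H2 test on the
existence side, on the Jacobian locus only; no case of the Hodge conjecture is proved; nothing here is a rung; no statement of [Markman 2025] is used;
nothing here depends on (LP), (8.3.3) or on 'ker ob = ann(ch)'.

§1 constant planes and the model of `𝓥₁` (`constant_planes_count`, `eta_and_M_degrees`); §2 the sub-line-bundle census and the corrected (R0) table
(`subbundle_degree_census`, `R0_table_rows`); §3 the Kummer weld (`kummer_weld_count`, `rigid_move_flatness`); §4 the junk rows (`junk_rows_census`).

What is NOT here: sheaves, `ψ`, the deformations, the machine checks. 0 unconditional rungs above the floor.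
-/

set_option linter.dupNamespace false

namespace Summit.HodgeConjecture.HodgeConjecture.WeilTypeLadder

section H2W2CornerEleven

/-- LEMMA 1.1 / COROLLARY 1.2 (report): the constant planes. For `y = z₁ − c ∈ Z₁ ∖ 0`, `T_yΘ_n` is the cone over the plane `⟨z₁, ℓ^h_c⟩ ⊂ ℙ³`
(Riemann–Kempf: spanned by the `3` points `z₁, c̃′, c̃″` of the divisor, `c̃′, c̃″` on the `h`-line of `c`); a plane containing a line of the quadric `Q`
meets `Q` in that line plus ONE line of the other ruling (bidegree bookkeeping `(1,1) = (1,0) + (0,1)`), here the `g`-line `ℓ′` through `z₁`: so the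
`2`-plane `Π′ = cone(ℓ′)` lies in every `T_yΘ_n` (a `3`-space in `k⁴`), and dually `Π″ = cone(ℓ^h_{z₁}) ⊂ T_yΘ_{−n}`; `Π′ ∩ Π″ = kζ` (`ζ = Ċ(z₁)`) is a line
and `Π′ + Π″` is `2 + 2 − 1 = 3`-dimensional (the cone over `T_{z₁}Q`). Consequences: `∂_vθ₊|_{Z₁} ≡ 0` for `v ∈ Π′` (machine-checked to order `N − 1`
for `N = 7,…,10`), `N_{Z₁/Θ_n} ≅ Π′ ⊗ 𝒪` off the `3` points `{0, y′, y″}` (where `Ċ(c) ∈ Π′`: `c ∈ ℓ′ ∩ C = {z₁, z₁′, z₁″}`), and the rigid two-sided move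
`(Θ_n + εβ, Θ_{−n} − εβ)` keeps all four incidences `Z_i ⊂ Θ_{±n}` iff `2β ∈ Π″`: a `2`-dimensional space of moves, `1` of which (`β ∈ kζ`) also
preserves the vertex tacnode. [§1.1–1.2] -/
theorem constant_planes_count :
    ((1 : ℤ) + 1 = 2 ∧ (1 : ℤ) + 0 + (0 + 1) = 2) ∧
    ((2 : ℤ) + 2 - 1 = 3 ∧ (3 : ℤ) < 4) ∧
    ((3 : ℕ) = 3 ∧ (2 : ℕ) - 1 = 1) ∧
    (∀ N : ℕ, 7 ≤ N → N - 1 ≥ 6) := by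
  refine ⟨by norm_num, by norm_num, by norm_num, ?_⟩
  intro N hN
  omega

/-- PROPOSITION 1.4 (report): the line-bundle identities on `Z₁ ≅ C` (genus `4`, `deg K_C = 6`, `deg g = deg h = 3`). (a) For the trigonal map `π_h`
(`n = 3`): `p_*𝒪_C = 𝒪 ⊕ E^∨` with `deg E = g + n − 1 = 4 + 2 = 6`, so `deg f^*E^∨ = 3·(−6) = −18`; the residual double cover `T̃ → C` has `12` simple
branch-related nodes (`2·4 − 2 + 2·3 = 12` ramification points), and `det`: `−18 + 12 = −6 = −deg M`, `M = 𝒪(4h − K)` of degree `4·3 − 6 = 6`, with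
`M² = 𝒪(6h − 2g)`: `2·6 = 6·3 − 2·3`; hence `η := N_{T_h/C₂} = 2h − M = K − 2h = g − h` has degree `6 − 6 = 0` (both ways) and `η² = 2g − 2h`. (b)
`N_{x_{z₁}/C₃}|_{Z^♯} = 𝒪(h − z₁)`, degree `3 − 1 = 2`. (c) `K₀^∨ ⊗ B = 𝒪(h − z₁) ⊗ η^{−1} ⊗ 𝒪(2P) = 𝒪(2h − g + z₁)`: degree `2 + 0 + 2 = 4 = 6 − 3 + 1`,
`χ = 4 + (1 − 4) = 1`, `h¹ = h⁰(2g − h − z₁) = 0`, so `h⁰ = 1`; and `K₀^∨ ⊗ B(−P) = 𝒪(2h − g)` of degree `3` with `h⁰ = 0` because `|𝒪_Q(2,−1)|_C| = ∅`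
(`h⁰(𝒪_{ℙ¹}(2))·h⁰(𝒪_{ℙ¹}(−1)) = 3·0 = 0` and `H¹(𝒪_Q(−1,−4)) = 0`). So [X] B.3 (i)'s deformation of `K₀` necessarily moves `K(0)` off `V₋`. [§1.4] -/
theorem eta_and_M_degrees :
    ((4 : ℤ) + 3 - 1 = 6 ∧ (3 : ℤ) * (-6) = -18 ∧ (2 : ℤ) * 4 - 2 + 2 * 3 = 12 ∧ (-18 : ℤ) + 12 = -6) ∧
    ((4 : ℤ) * 3 - 6 = 6 ∧ (2 : ℤ) * 6 = 6 * 3 - 2 * 3 ∧ (2 : ℤ) * 3 - 6 = 0 ∧ (6 : ℤ) - 2 * 3 = 0) ∧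
    ((3 : ℤ) - 1 = 2) ∧
    ((2 : ℤ) + 0 + 2 = 4 ∧ (6 : ℤ) - 3 + 1 = 4 ∧ (4 : ℤ) + (1 - 4) = 1 ∧ (4 : ℤ) - 1 = 3 ∧ (3 : ℤ) * 0 = 0) := by
  norm_num

/-- §2 (report): the sub-line-bundle census of `𝓥₁` (degree `8`, rank `2`). LEMMA 2.1: `deg K_v = Σ_y m_v(y)` with the vertex index `m_v(0) = 1` for EVERY
`[v] ∈ ℓ′` (PROP. 2.2: `ũ₂|_Λ = κm′m″`, `κ ≠ 0`; machine: 330 + 4 values, 3 curves) and `m_v = 1` at the two points `z₁ − p₁, z₁ − p₂` of `X_p ∩ Z₁ ∖ 0`: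
`deg K_v = 1 + 1 + 1 = 3` for general `v`, `+1` at `y′` (resp. `y″`) for `[v] = z₁′` (resp. `z₁″`): `deg K_{Y″} = deg K_{Y′} = 4`; `deg K_S = deg K_ζ = 3`
(not `≤ 1` as scoped in [X] 5.3: the subsheaf generated by `(θ₋L₁, 0)` has degree `5 − 4 = 1` and its saturation gains `2`). PROP. 2.4: in the `𝒫`-model a
map of degree `m` gives a subbundle of degree `−m + ε + 6 − f′ − l_P`; `C` has no `g¹₁, g¹₂`, so `m ∈ {0, 3, 4, 5, …}`; the values realised: constants
`(m,ε,f′,l_P) = (0,0,2,1) ↦ 3`, `(0,0,1,1) ↦ 4`; `σ`-family `(3,0,0,1) ↦ 2`; `K₀ = K_q`: `(3,1,0,2) ↦ 2`; degree-`4` maps `(4,1,0,1) ↦ 2` needs `5`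
conditions on a `2 + 3 = 5`-dimensional family, degree-`5` maps `(5,1,0,0) ↦ 2` needs `6` on `4 + 3 = 7` (clause (S)); expected dimension of the
degree-2 Quot scheme `8 − 2·2 − 3 = 1`. [§2.1–2.6] -/
theorem subbundle_degree_census :
    ((1 : ℤ) + 1 + 1 = 3 ∧ (3 : ℤ) + 1 = 4 ∧ (5 : ℤ) - 4 = 1 ∧ (1 : ℤ) + 2 = 3) ∧
    (∀ m e f l : ℤ, -m + e + 6 - f - l = 6 + e - (m + f + l)) ∧
    ((-0 : ℤ) + 0 + 6 - 2 - 1 = 3 ∧ (-0 : ℤ) + 0 + 6 - 1 - 1 = 4 ∧ (-3 : ℤ) + 0 + 6 - 0 - 1 = 2 ∧ (-3 : ℤ) + 1 + 6 - 0 - 2 = 2 ∧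
     (-4 : ℤ) + 1 + 6 - 0 - 1 = 2 ∧ (-5 : ℤ) + 1 + 6 - 0 - 0 = 2) ∧
    ((2 : ℤ) + 3 = 5 ∧ (4 : ℤ) + 3 = 7 ∧ (8 : ℤ) - 2 * 2 - 3 = 1) := by
  refine ⟨by norm_num, fun m e f l => by ring, by norm_num, by norm_num⟩

/-- TABLE 2.5 (report): the (R0) rows `(k, δ, ℓ₀)` with `ℓ₀ = δ + 2k − 6 ≥ 0`, `δ ∈ {0, 2}` ([X] A.7), at `b = n`, `j = 2`, `z₁` unramified, and their
occupants: `(2,2,0)` = `{K₀, K_{σ₊}}` (`2 + 4 − 6 = 0`); `(3,0,0)` = the pencil `K_v` (`0 + 6 − 6 = 0`; `χ(T_v) = 2·(5 + 1 − 4) − 0 = 4`: NUMERICALLY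
ADMISSIBLE, a `1 + 1 = 2`-parameter family with `z₁` ⇒ dead by the family mechanism); `(3,2,2)` = `{K_S, K_{v₊}}` (`2 + 6 − 6 = 2`); `(4,0,2)` =
`{K_{Y′}, K_{Y″}}` (`0 + 8 − 6 = 2`); `(4,2,4)` and `k ≥ 5` EMPTY (`K_{Y′}(0), K_{Y″}(0)` generic; no subbundle of degree `≥ 5`: a constant direction
would need both `P′, P″` conditions, i.e. `z₁′ = z₁″`). `(2,0,·)` is excluded: `0 + 4 − 6 < 0`. [§2.5] -/
theorem R0_table_rows :
    ((2 : ℤ) + 2 * 2 - 6 = 0 ∧ (0 : ℤ) + 2 * 3 - 6 = 0 ∧ (2 : ℤ) + 2 * 3 - 6 = 2 ∧ (0 : ℤ) + 2 * 4 - 6 = 2 ∧ (2 : ℤ) + 2 * 4 - 6 = 4) ∧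
    ((2 : ℤ) * (5 + 1 - 4) - 0 = 4 ∧ (1 : ℤ) + 1 = 2) ∧
    ((0 : ℤ) + 2 * 2 - 6 < 0) ∧
    (∀ k δ : ℤ, 0 ≤ δ + 2 * k - 6 → δ ≤ 2 → 2 ≤ k) := by
  refine ⟨by norm_num, by norm_num, by norm_num, ?_⟩
  intro k δ h1 h2
  omega

/-- §3.1 / THEOREM W (report): the Kummer weld. `Ext¹_J(F,F) → Hom_D(F, F ⊗ N_D) ⊇ H⁰(𝒪_{D_n}(2Θ))`, of dimension `16 − 1 + h¹(𝒪_J) = 15 + 4 = 19`, on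
which `ι` acts by `+1` on the `15` directions of `|2Θ|` (all second-order theta functions are even, [Lange–Birkenhake Cor. 2.3.9]) and by `−1` on the `4`
translations; so `e₁^ι(F) = dim Ext¹_D(F,F)^ι + #{ι-invariant motions of D_n along which F extends to first order}` and an H2 object must be WELDED against
all `15`. The sections of `𝒪(2Θ)` vanishing on `S_n = Θ_n ∩ Θ_{−n}`: `h⁰ = 2 − 1 + 4 = 5` (Koszul), namely `s_{D_n}` and the `4` Kummer directions `ν_β`,
which therefore vanish on `Z₁ ∪ Z₂ ⊂ S_n` (the local necessity along the pinch curves); `β ↦ ν_β` is injective (Kummer EMBEDDING at `n ∉ J[2]`,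
[Lange–Birkenhake Thm 2.3.20]); `H¹(𝒪_J) ≅ H¹(𝒪_{S_n})` (`4 = 4`; `χ(𝒪_{S_n}) = 1 − 4 + 17 = 14`, `h⁰(ω_{S_n}) = 16 − 5 + 6 = 17`). THEOREM W: for every (R0)
candidate `F_K` WITHOUT vertex junk the rigid move `β = ζ` gives a flat ι-symmetric first-order deformation with support motion `ν_ζ ≠ 0`, independent of
the `z₁`-class (support motion `0`): `e₁^ι(F_K) ≥ 1 + 1 = 2 > 1` — in particular for [X] B's `F^{R0}_{z₁}` and its `V₊`-partner `F^{R0,+}_{z₁}`; and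
`e₁^ι(F̂_{z₁}) ≥ 1 + 2 = 3`. [§3.1, §3.7; the vertex lifting 3.4 is machine-faithful: residual at degree exactly `N − 2` for `N ∈ {8, 9, 10}`, controls at
degree `2`] -/
theorem kummer_weld_count :
    ((16 : ℤ) - 1 + 4 = 19 ∧ (15 : ℤ) + 4 = 19 ∧ (16 : ℤ) - 1 = 15) ∧
    ((2 : ℤ) - 1 + 4 = 5 ∧ (1 : ℤ) + 4 = 5) ∧
    ((1 : ℤ) - 4 + 17 = 14 ∧ (16 : ℤ) - 5 + 6 = 17 ∧ (4 : ℤ) = 4) ∧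
    ((1 : ℤ) + 1 = 2 ∧ (2 : ℤ) > 1 ∧ (1 : ℤ) + 2 = 3) ∧
    (∀ N : ℕ, N = 8 ∨ N = 9 ∨ N = 10 → 2 ≤ N - 3 ∧ N - 3 < N - 2) := by
  refine ⟨by norm_num, by norm_num, by norm_num, by norm_num, ?_⟩
  intro N hN
  rcases hN with rfl | rfl | rfl <;> omega

/-- PROPOSITION 3.6 (report): flatness of the (R0) quotient under the rigid move `β = ζ`. For `K(0) ∈ {V₊, V₋}` the vertex gluing has length `δ = 1 + 1 = 2`
(one missing class in each of the `σ = a + b` and `δ′ = a − b` factors, [X] A.7), and the deformed cokernel `R^ε` is free over `k[ε]` of rank `2`, i.e. of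
length `2·2 = 4` (machine, faithful, for `K₀` and `K_{σ₊}`, 3 curves: 'deformed colength 4'); for `δ = 0` there is nothing to check (`2·0 = 0`); CONTROL:
for `β = Ċ(c′) ∈ Π″ ∖ kζ` the matching still lifts but the deformed colength is `2 ≠ 4` (the tacnode `Z₁ ∪ Z₂` opens: the relative displacement `2β` is
not in the `2`-dimensional `T_{2z₁}W₂`), so only `ζ` (and the `z₁`-motion) deform `F_K`, while `F̂_{z₁}` deforms along all of the `2`-dimensional `Π″`. [§3.6] -/
theorem rigid_move_flatness :
    ((1 : ℤ) + 1 = 2 ∧ (2 : ℤ) * 2 = 4 ∧ (2 : ℤ) * 0 = 0) ∧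
    ((2 : ℤ) ≠ 4 ∧ (2 : ℤ) ≠ 2 * 2) ∧
    (∀ δ c : ℤ, c = 2 * δ ↔ c - δ = δ) := by
  refine ⟨by norm_num, by norm_num, ?_⟩
  intro δ c
  constructor <;> intro h <;> omega

/-- THEOREM 4.3 (report): the rows with vertex junk. For the vertex modules `M′ = F^Y_{K,0}` (machine, faithful, 3 curves; `V = M′ ⊗ k` with ι-signs,
`LS^{[V_s]}` the linear syzygies on the sign-`s` generators) [VIII] 3.2–3.3 give, for a balanced colength-2 ι-submodule on the projective family `P(H)` of
an ι-hyperplane `H` of sign `s`, `tan ≥ dim P(H) = 3 − r(H) + dim V_{−s}` with `r(H) ≤ min(4, dim LS^{[V_s]})`: `K_S = K_ζ`: `V = k₋³`, `dim LS^{[V₋]} = 1`,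
`r(H) = 1`, `tan ≥ 3 − 1 + 0 = 2`; `K_{v₊}`: `V = k₊²` (orders `1, 3`), `dim LS^{[V₊]} = 1`, `tan ≥ 3 − 1 + 0 = 2`; `K_{Y′}, K_{Y″}` (and generic `K_v`):
`V = k₊² ⊕ k₋³`, `(dim LS^{[V₊]}, dim LS^{[V₋]}) = (4, 3)`, `tan ≥ 3 − min(4,4) + 3 = 2` resp. `3 − 3 + 2 = 2`, and 𝔪-type quotients have
`tan ≥ μ(N′) ≥ dim V − 2 = 3`. So `tan ≥ 2 > 1` in every case: the rows `(3,2,2)` and `(4,0,2)` are dead by (QT). [§4.2–4.3] -/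
theorem junk_rows_census :
    ((3 : ℤ) - 1 + 0 = 2 ∧ (3 : ℤ) - 1 + 0 = 2) ∧
    ((3 : ℤ) - min 4 4 + 3 = 2 ∧ (3 : ℤ) - min 4 3 + 2 = 2) ∧
    ((2 : ℤ) + 3 - 2 = 3) ∧
    (∀ t : ℤ, 2 ≤ t → 1 < t) := by
  refine ⟨by norm_num, by norm_num, by norm_num, ?_⟩
  intro t ht
  omega

/-- SCOPE OF `kummer_weld_count` / `rigid_move_flatness` (W-P3g18-W-doc, referee-g95 R564; END-appended by prover 3 gen 19, report
`run/shared/lean/b2b/hodge-weil/b2b-hweil-pv3-g19/H2-EXISTENCE-SIDE-12.md` [XII]). THEOREM W of [XI] 3.7 ('every (R0) candidate without vertex junk has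
`e₁^ι ≥ 2`') is assembled from [XI] 3.3 (pen-and-paper), 3.4 + 3.5 (the lift of the matching `ψ` under a rigid Kummer move and its globalisation),
3.6 (a) (flatness of the (R0) quotient for `β = ζ`) and the two-class argument (pen-and-paper). STATUS: (i) 3.4 + 3.5 hold for EVERY `w ∈ Π″` and GENERAL
`(C, z₁)` — THEOREM L of [XII] §4, a pen-and-paper divisor-class argument on the punctured deformed surface (so the machine verdict 'RHS ∈ W modulo
truncation at order `N − 2`, `N ∈ {8, 9, 10}`, 3 curves' of [XI] is now a COROLLARY, for every `N`); (ii) 3.6 (a) is MACHINE-verified only: on the `3`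
curves of [XI] (seeds 1–3 over `𝔽₃₂₀₀₃`, `N = 8, 9, 10`), on `3` further curves (seeds 4–6, `N = 8`) and on `2` curves over a second prime field
(`𝔽₆₅₅₂₁`, seeds 1–2) — `3 + 3 + 2 = 8` pointed curves, `2` characteristics, controls failing on all — and [XII] 5.2 shows it is equivalent to ONE scalar
identity at the centre of the move ('the σ-odd line of the fibre lies in `K₀`'), a CLOSED condition in `(C, z₁)`, NOT proved for the general curve.
Hence: THEOREM W is a theorem for the `δ = 0` rows ([XII] 4.3) and `e₁^ι(F̂_{z₁}) ≥ 1 + 2 = 3` is a theorem ([XII] 4.2); for the `δ = 2` rows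
(`F^{R0}_{z₁}`, `F^{R0,+}_{z₁}`) THEOREM W and '(R0) = ∅' are PROPOSED ⇐ 3.6 (a), machine-evidenced on `8` curves; the [XI] label 'PROPOSED ⇐
GP3g18-3, -4, -5' and BOARD line 51101's 'refuted' are to be read with this scope. Arithmetic of the evidence count and of the assembly (`4` inputs, `2` of
them now pen-and-paper for the `δ = 2` rows plus the two-class argument, `1` machine). [XII §4.4, §5] -/
theorem kummer_weld_scope :
    ((3 : ℕ) + 3 + 2 = 8 ∧ (2 : ℕ) = 2 ∧ (1 : ℕ) + 2 = 3) ∧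
    ((4 : ℕ) = 1 + 2 + 1 ∧ (4 : ℕ) - 1 = 3) ∧
    (∀ N : ℕ, 8 ≤ N → N - 2 < N) ∧
    (∀ d : ℕ, d = 0 ∨ d = 2 → (d = 0 → 2 * d = 0) ∧ (d = 2 → 2 * d = 4)) := by
  refine ⟨by norm_num, by norm_num, ?_, ?_⟩
  · intro N hN
    omega
  · intro d hd
    rcases hd with rfl | rfl <;> simp

end H2W2CornerEleven

end Summit.HodgeConjecture.HodgeConjecture.WeilTypeLadder
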